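import Literature.MathematicalPhysics.QuantumFieldTheory.Balaban1983to89.B11Thm1ExistsUniqueRealisedDataB
import Literature.MathematicalPhysics.QuantumFieldTheory.Balaban1983to89.B15Prop1Thm1GeneralFormAtZSequence

/-!
# `Balaban1983to89.B11Thm1ExistsUniqueRealisedDataQsstar` — [Balaban1989LargeFieldI] (1.74) p. 192, p. 193 ll. 14–20 ∕ [Balaban1988Convergent] (2.16) p. 257 ∕
# [Balaban1985Variational] (7) p. 278, (11)–(14) pp. 279–280: ★★ THE (1.74) ∕ (2.16) DATUM `M˙(Q_k^{s*}V)` IS REGULAR-REALISED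
# (`B11Thm1ExistsUniqueRealisedDataB.DataRegularRealisedTop`) — along any sequence whose ranges lie in a `k`-block union on which `V` is small (§1), and at `Z`'s maximal
# sequence (2.13) with the ranges DISCHARGED by the printed distance condition (§2–§3)

Honest framing: statement-level skeleton of published theorems with citation tags; proofs where landed; nothing here is a claim about the Yang–Mills mass gap.  Cell `pub-ymgap`
(HUMAN RULINGS D-0062 ∕ D-0149), lane `pub-ymgap-dag-n12-c` g38 (R134 seat (a), N12 = [B15], s1).  `--kind proof --supports` K1⁹ `stmt-QuantumFields-27364`; count-neutral; THEOREMS ONLY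
(0 `def`, 0 `sorry`, 0 `instance`).

WHY.  N12's junction at print's datum (dag-n12-d g33, 165∕168) applies the [15]-Theorem-1 (E∕U) letter at the ONE datum `W := M˙(Q_k^{s*}Ṽ_k) = avgFamily (avOfRecord F 2 Kt)
(qsstarGIter0 (k i) (ext i Vk))` ([IV] p. 193 ll. 14–16 *«V_k′ = Ṽ_k on Z … This configuration satisfies all the above conditions»*), certifying print's (7) for it by the lane's
`B15Prop1DatumSmall7AtZSequence.dataSmall7PTop_avgFamily_qsstarGIter0` (g11).  The lane's regular-realised predicate — at which the SUPPLY-at-1 ∕ LIFT tokens are PROVED and the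
(E∕U)ᴮ name follows from the ONE-LENGTH STEP token and K0's (R)ᴮ name alone (`B11Thm1ExistsUniqueRealisedDataBBridges`, `Summit.…N12EUStepTokensAtRealisedDataLam`) — holds for the same
datum by the same two facts: (i) `M˙(Q^{s*}V)` is realised BY CONSTRUCTION (`M^{j+1}(U) = M(M^j(U))`, `Setup.Averaging.iter`); (ii) a plaquette variable of a pulled-back field is `1` or the
plaquette variable of `V` on the block plaquette (`plaqHol_qsstarGIter[0]_dichotomy`), so EVERY level of the datum is `δ`-small on every range of plaquettes lying inside the block union
`Y` on which `V` is `δ`-small (`plaqSmallOn_qsstarGIter[0]_of_isBlockUnion`) — in particular on the FULL ranges `plaqsOf (pts n (Ω n))`, `plaqsOf Ω₀`, `plaqsOf (Ω 1)` of the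
regular-realised predicate, not only on print's (7) ranges.  This is the junction's one-call discharge of the new data row (in place of `dataSmall7PTop_avgFamily_qsstarGIter0`).

CONTENTS.
* §1 ★★ `dataRegularRealisedTop_avgFamily_qsstarGIter0` — generic lattice `P`, gauge group `G`, Bałaban's (0.4) averaging `blockAvg ℰ` (`ℰ(1,…,1) = 1`), any sequence `Ω` (`1 ≤ k ≤ m+K`),
  top domain `Ω₀`, block union `Y ⊇` the ranges (`plaqsOf Ω₀ ⊆ plaqsInside Y`, `plaqsOf (Ω 1) ⊆ plaqsInside Y`, `plaqsOf (pts n (Ω n)) ⊆ plaqsInside Y^{(n)}` for `1 ≤ n ≤ k`),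
  thresholds `0 < δ_j`, `V` `δ_j`-small on the plaquettes inside `Y^{(k)}`.
* §2 geometry at `Z`'s maximal sequence `maxDomT M₁ Z` ([III] (2.13); `M₁ ≥ 2`, torus divisibility `LᴶM₁ ∣ 2L^{m+K}`, `1 ≤ J`): ★ `plaqsOf_hullD_maxDomT_one_subset_plaqsInside` (EVERY fine
  plaquette meeting the support `Ω₁(Z) +` one layer of `M₁`-cubes lies inside `Z` — the strong form of g11's `printedPlaqsTop_maxDomT_subset_plaqsInside`, same cover bookkeeping) and
  `plaqsOf_maxDomT_one_subset_plaqsInside` (the plaquettes meeting `Ω₁(Z)` itself: corners within `1 ≤ LM₁ − 1`).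
* §3 ★★ `dataRegularRealisedTop_avgFamily_qsstarGIter0_maxDomT` — §1 at `Ω := maxDomT M₁ Z`, `Ω₀ := hullD P M₁ 1 (Ω₁(Z))` (node00-def-R's selector of record, up to `suppDomOfRecord_congr`),
  `Y := Z` (`IsBlockUnion k Z`), the three range letters DISCHARGED by §2 and g12's `plaqsOf_pts_maxDomT_subset_plaqsInside`.

HONEST SCOPE.  Lattice bookkeeping over landed kernel theorems (the Q^{s*} section property and its plaquette dichotomy, r11's printed distance condition); nothing of Bałaban's estimates
asserted; no token inhabited here beyond a data row; K0⁷ ∕ K1⁹ NOT closed; N12 NOT discharged; counts unmoved (discharged 8∕27); one finite 𝕋⁴ programme at fixed ε — the route closes the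
conditional finite-𝕋⁴ rung `BalabanLadder.UV` only; nothing continuum ∕ ℝ⁴ ∕ OS; the Yang–Mills mass gap (Clay) is NOT proved by any of this.

References: [IV] = [Balaban1989LargeFieldI] (1.74) p.192, p.193 L14–20; [III] = [Balaban1988Convergent] (2.2) p.255, (2.11)–(2.13) pp.256–257, (2.16) p.257; [15] = [Balaban1985Variational]
(7) p.278, (11) p.279, (14) p.280; [BalabanImbrieJaffe1985] (4.5.3) p.312; [Balaban1985RegularSpaces] (1.5),(1.7) p.77.
-/

noncomputable section

open Set

namespace Literature.MathematicalPhysics.QuantumFieldTheory.Balaban1983to89.B11Thm1ExistsUniqueRealisedDataB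

open B15DeterminingSets GaugeField B8Eq17ClassAkV1 BlockAveraging
open B15Prop1Carrier (plaqsInside)
open B14.Eq22Determines (IsBlockUnion)
open Literature.MathematicalPhysics.QuantumFieldTheory.BalabanImbrieJaffe1984to88.BIJ85Eq453GaugeField (qsstarGIter0)
open B15Prop1DatumSmall7AtZSequence (iter_blockAvg_qsstarGIter0_add plaqSmallOn_qsstarGIter_of_isBlockUnion plaqSmallOn_qsstarGIter0_of_isBlockUnion cover_add_single_pow)
open B15Prop1Thm1GeneralFormAtZSequence (plaqsOf_pts_maxDomT_subset_plaqsInside)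

/-! ## §1  `M˙(Q_k^{s*}V)` is regular-realised along any sequence whose ranges lie in a block union on which `V` is small -/

section Generic

variable {P : Params} {G : Type*} [GaugeGroup G]

/-- ★★ **THE (1.74)∕(2.16) DATUM `M˙(Q_k^{s*}V)` IS REGULAR-REALISED** — for Bałaban's (0.4) averaging `av = blockAvg ℰ` (`ℰ(1,…,1) = 1`), any sequence `Ω` with `1 ≤ k ≤ m+K` levels,
top domain `Ω₀`, a union `Y` of `k`-blocks containing the three kinds of ranges, and positive thresholds `δ_j` at which `V` is small on the plaquettes inside `Y^{(k)}`: (R) realised by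
construction (`M^{n+1} = M ∘ M^n`); (F₀) ∕ (F₁) the fine member `Q_k^{s*}V` on `plaqsOf Ω₀` ∕ `plaqsOf (Ω 1)` by the base-`0` smallness transfer; (Fₙ) the level-`n` member `M^n(Q_k^{s*}V) =
Q^{s*}_{k−n}V` (section property) on `plaqsOf (pts n (Ω n))` by the base-`n` transfer. [cite: Balaban1989LargeFieldI, (1.74) p.192, p.193 L14–16; Balaban1988Convergent, (2.11) p.256, (2.16) p.257; Balaban1985Variational, (7) p.278, (11) p.279] -/
theorem dataRegularRealisedTop_avgFamily_qsstarGIter0 (hd : 2 ≤ P.d) (ℰ : LoopAverage G)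
    (hE : ∀ n : ℕ, ℰ.E (fun _ : Fin (n + 1) => (1 : G)) = 1) {av : ∀ j, Averaging P j G} (hav : av = fun _ => blockAvg ℰ)
    {k : ℕ} (hk : k ≤ P.m + P.K) (Ω : ℕ → Set (Site P 0)) (Ω₀ Y : Set (Site P 0)) (hY : IsBlockUnion k Y)
    (h0 : plaqsOf Ω₀ ⊆ plaqsInside Y) (h1 : plaqsOf (Ω 1) ⊆ plaqsInside Y)
    (hfull : ∀ n, 1 ≤ n → n ≤ k → plaqsOf (pts n (Ω n)) ⊆ plaqsInside (pts n Y))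
    {δ : ℕ → ℝ} (hδ0 : 0 < δ 0) (hδ1 : 0 < δ 1) (hδ : ∀ j, 1 ≤ j → j ≤ k → 0 < δ j) (V : GaugeField P k G)
    (hV0 : PlaqSmallOn (plaqsInside (pts k Y)) (δ 0) V) (hV1 : PlaqSmallOn (plaqsInside (pts k Y)) (δ 1) V)
    (hV : ∀ j, 1 ≤ j → j ≤ k → PlaqSmallOn (plaqsInside (pts k Y)) (δ j) V) :
    DataRegularRealisedTop av Ω Ω₀ k δ (avgFamily av (qsstarGIter0 k V)) := by
  subst hav
  refine ⟨fun n _ => rfl, plaqSmallOn_qsstarGIter0_of_isBlockUnion hd hk hY h0 hδ0 hV0,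
    plaqSmallOn_qsstarGIter0_of_isBlockUnion hd hk hY h1 hδ1 hV1, fun n hn1 hn => ?_⟩
  obtain ⟨j, rfl⟩ := Nat.exists_eq_add_of_le hn
  show PlaqSmallOn _ _ (Averaging.iter (fun i => blockAvg ℰ) n (qsstarGIter0 (n + j) V))
  rw [iter_blockAvg_qsstarGIter0_add ℰ hE (by omega) V]
  exact plaqSmallOn_qsstarGIter_of_isBlockUnion hd hk hY (hfull n hn1 hn) (hδ n hn1 hn) (hV n hn1 hn)

end Generic

/-! ## §2  Geometry at `Z`'s maximal sequence: the fine plaquettes meeting the support lie inside `Z` -/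

section ZRanges

open B15Eq112TorusCover (cover lift per cover_apply cover_lift cover_eq_cover_iff cover_add_pmul)
open B14DomainGeom (Pt Within)
open B15LatticeCubeTorus (pmul)
open B14.Eq213MaximalDomains (side)
open B14.Eq213DetSet (maxDomT maxDomT_zero maxDomT_subset dist_maxDomT)

variable {P : Params}

/-- Sup-distance `≤ t` between any two corners `x + a e_μ + b e_ν`, `a, b ∈ {0, t}`, `μ ≠ ν` (local copy of g11's private lemma). [folklore] -/
private theorem within_corner' {d : ℕ} (x : Pt d) {μ ν : Fin d} (hne : μ ≠ ν) {t : ℤ} (ht : 0 ≤ t) {a b a' b' : ℤ}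
    (ha : a = 0 ∨ a = t) (hb : b = 0 ∨ b = t) (ha' : a' = 0 ∨ a' = t) (hb' : b' = 0 ∨ b' = t) :
    Within t (x + Pi.single μ a + Pi.single ν b) (x + Pi.single μ a' + Pi.single ν b') := by
  intro i
  simp only [Pi.add_apply]
  rw [abs_le]
  by_cases hμ : i = μ
  · subst hμ
    rw [Pi.single_eq_same, Pi.single_eq_same, Pi.single_eq_of_ne hne, Pi.single_eq_of_ne hne]
    rcases ha with ha | ha <;> rcases ha' with ha' | ha' <;> constructor <;> linarith
  · by_cases hν : i = ν
    · subst hν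
      rw [Pi.single_eq_same, Pi.single_eq_same, Pi.single_eq_of_ne hμ, Pi.single_eq_of_ne hμ]
      rcases hb with hb | hb <;> rcases hb' with hb' | hb' <;> constructor <;> linarith
    · rw [Pi.single_eq_of_ne hμ, Pi.single_eq_of_ne hμ, Pi.single_eq_of_ne hν, Pi.single_eq_of_ne hν]
      constructor <;> linarith

/-- ★ **EVERY FINE PLAQUETTE MEETING THE SUPPORT `Ω₁(Z) +` ONE LAYER OF `M₁`-CUBES LIES INSIDE `Z`** — the strong form of g11's `printedPlaqsTop_maxDomT_subset_plaqsInside` (the same proof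
reads only the membership in `plaqsOf` of the support): a fine plaquette meeting `hullD … M₁ 1 (Ω₁(Z))` ([III] p. 255 *«a small neighborhood of Ω₁ including a layer of M₁-cubes»*) has all
four corners within sup-distance `2M₁ ≤ LM₁ − 1` (`L ≥ 3`) of a point of `Ω₁(Z)`, hence in `Ω₀(Z) = Z` by *«dist(Ω₁, Ωᶜ₀) ≧ LξM₁»* (r11's `dist_maxDomT`; divisibility `LᴶM₁ ∣ 2L^{m+K}`, `1 ≤ J`).
This is the (F₀) range letter of the regular-realised predicate at the record. [cite: Balaban1988Convergent, p.255, (2.13) pp.256–257; Balaban1985Variational, (2),(7) p.278] -/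
theorem plaqsOf_hullD_maxDomT_one_subset_plaqsInside {M₁ : ℕ} (hM : 1 ≤ M₁) {Z : Set (Site P 0)} {J : ℕ}
    (hdiv : side P.L M₁ J ∣ P.sitesPerDir 0) (hJ : 1 ≤ J) :
    plaqsOf (Node00.hullD P M₁ 1 (maxDomT M₁ Z 1)) ⊆ plaqsInside Z := by
  intro p hp'
  -- the four corners on the cover
  set x : Pt P.d := lift P p.src with hxdef
  let q : ℤ → ℤ → Pt P.d := fun a b => x + Pi.single p.μ a + Pi.single p.ν b
  have hstep : ∀ {y : Pt P.d} {c : Site P 0}, cover P y = c → ∀ μ, cover P (y + Pi.single μ 1) = c.shift μ := by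
    intro y c hy μ
    have h := cover_add_single_pow (P := P) 0 (c := c) hy μ
    rwa [pow_zero] at h
  have hq00 : cover P (q 0 0) = p.src := by
    show cover P (x + Pi.single p.μ 0 + Pi.single p.ν 0) = _
    rw [Pi.single_zero, Pi.single_zero, add_zero, add_zero, hxdef, cover_lift]
  have hq10 : cover P (q 1 0) = p.src.shift p.μ := by
    show cover P (x + Pi.single p.μ 1 + Pi.single p.ν 0) = _
    rw [Pi.single_zero, add_zero, hstep (by rw [hxdef, cover_lift]) p.μ]
  have hq01 : cover P (q 0 1) = p.src.shift p.ν := by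
    show cover P (x + Pi.single p.μ 0 + Pi.single p.ν 1) = _
    rw [Pi.single_zero, add_zero, hstep (by rw [hxdef, cover_lift]) p.ν]
  have hq11 : cover P (q 1 1) = (p.src.shift p.μ).shift p.ν := by
    show cover P (x + Pi.single p.μ 1 + Pi.single p.ν 1) = _
    rw [hstep _ p.ν]
    rw [hstep (by rw [hxdef, cover_lift]) p.μ]
  have hne : p.μ ≠ p.ν := ne_of_lt p.hμν
  -- one corner lies in the support: in an `M₁`-cube whose one-layer collar meets `Ω₁(Z)`
  have h0 : ∃ a b, (a = 0 ∨ a = 1) ∧ (b = 0 ∨ b = 1) ∧ cover P (q a b) ∈ Node00.hullD P M₁ 1 (maxDomT M₁ Z 1) := by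
    rcases hp' with h | h | h | h
    · exact ⟨0, 0, Or.inl rfl, Or.inl rfl, by rw [hq00]; exact h⟩
    · exact ⟨1, 0, Or.inr rfl, Or.inl rfl, by rw [hq10]; exact h⟩
    · exact ⟨0, 1, Or.inl rfl, Or.inr rfl, by rw [hq01]; exact h⟩
    · exact ⟨1, 1, Or.inr rfl, Or.inr rfl, by rw [hq11]; exact h⟩
  obtain ⟨a₀, b₀, ha₀, hb₀, hmem⟩ := h0
  classical
  simp only [Node00.hullD, Set.mem_iUnion, Finset.mem_filter] at hmem
  obtain ⟨a, ⟨_, ⟨z, hz1, hzΩ⟩⟩, hc⟩ := hmem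
  -- lifts: the corner `ĉ` in the cube, the witness `ẑ` in its collar
  simp only [Node00.cubeEnl, Set.mem_image] at hz1 hc
  obtain ⟨zh, hzh, rfl⟩ := hz1
  obtain ⟨ch, hch, hcq⟩ := hc
  -- re-centre the deck translation between `ch` and `q a₀ b₀`
  obtain ⟨v, hv⟩ := (cover_eq_cover_iff (q a₀ b₀) ch).1 hcq.symm
  set zh' : Pt P.d := zh - pmul (per P) v with hzh'
  have hzcov : cover P zh' ∈ maxDomT M₁ Z (0 + 1) := by
    have : zh = zh' + pmul (per P) v := by rw [hzh', sub_add_cancel]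
    rw [this, cover_add_pmul] at hzΩ
    exact hzΩ
  -- sup-distance from `zh'` to every corner ≤ 2M₁ ≤ LM₁ − 1
  have hL3 : (3 : ℤ) ≤ P.L := by
    have h1 := P.hL.2
    obtain ⟨r, hr⟩ := P.hL.1
    omega
  have hM' : (1 : ℤ) ≤ M₁ := by exact_mod_cast hM
  have hW : ∀ a b, (a = 0 ∨ a = 1) → (b = 0 ∨ b = 1) → Within ((side P.L M₁ (0 + 1) : ℤ) - 1) zh' (q a b) := by
    intro a b ha hb i
    have hside : (side P.L M₁ (0 + 1) : ℤ) = P.L * M₁ := by simp [side, Nat.cast_mul]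
    rw [hside]
    have hcorner := within_corner' x hne (zero_le_one) ha₀ hb₀ ha hb i
    have hz := hzh i
    have hc' := hch i
    have hvq : ch i = (q a₀ b₀) i + (pmul (per P) v) i := by rw [hv]; rfl
    have hz' : zh' i = zh i - (pmul (per P) v) i := by rw [hzh']; rfl
    rw [hz']
    have e1 : |zh i - ch i| ≤ 2 * (M₁ : ℤ) - 1 := by
      rw [abs_le]; push_cast at hz hc' ⊢; constructor <;> nlinarith [hz.1, hz.2, hc'.1, hc'.2]
    calc |zh i - (pmul (per P) v) i - (q a b) i|
        = |(zh i - ch i) + ((q a₀ b₀) i - (q a b) i)| := by rw [hvq]; ring_nf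
      _ ≤ |zh i - ch i| + |(q a₀ b₀) i - (q a b) i| := abs_add_le _ _
      _ ≤ (2 * (M₁ : ℤ) - 1) + 1 := add_le_add e1 hcorner
      _ ≤ P.L * M₁ - 1 := by nlinarith
  have H : ∀ a b, (a = 0 ∨ a = 1) → (b = 0 ∨ b = 1) → cover P (q a b) ∈ Z := fun a b ha hb => by
    have h := dist_maxDomT hM hdiv hJ hzcov (hW a b ha hb)
    rwa [maxDomT_zero] at h
  refine ⟨?_, ?_, ?_, ?_⟩
  · rw [← hq00]; exact H 0 0 (Or.inl rfl) (Or.inl rfl)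
  · rw [← hq10]; exact H 1 0 (Or.inr rfl) (Or.inl rfl)
  · rw [← hq01]; exact H 0 1 (Or.inl rfl) (Or.inr rfl)
  · rw [← hq11]; exact H 1 1 (Or.inr rfl) (Or.inr rfl)

/-- **THE FINE PLAQUETTES MEETING `Ω₁(Z)` LIE INSIDE `Z`** — a fine plaquette with a corner in `Ω₁(Z)` has all four corners within sup-distance `1 ≤ LM₁ − 1` of it, hence in `Ω₀(Z) = Z`
by *«dist(Ω₁, Ωᶜ₀) ≧ LξM₁»* (r11's `dist_maxDomT`; divisibility `LᴶM₁ ∣ 2L^{m+K}`, `1 ≤ J`) — the (F₁) range letter of the regular-realised predicate at the record.  Literature-side twin of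
the Summits-side `Summit.…BalabanUVNodes.N20LCSMinimiserEnergyComparison.plaqsOf_maxDomT_one_subset_plaqsInside` (dag-n20 lineage; same statement), which a Literature module cannot import.
[cite: Balaban1988Convergent, p.255, (2.13) pp.256–257; Balaban1985Variational, (14) p.280] -/
theorem plaqsOf_maxDomT_one_subset_plaqsInside {M₁ : ℕ} (hM : 1 ≤ M₁) {Z : Set (Site P 0)} {J : ℕ}
    (hdiv : side P.L M₁ J ∣ P.sitesPerDir 0) (hJ : 1 ≤ J) :
    plaqsOf (maxDomT M₁ Z 1) ⊆ plaqsInside Z := by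
  intro p hp'
  -- the four corners on the cover
  set x : Pt P.d := lift P p.src with hxdef
  let q : ℤ → ℤ → Pt P.d := fun a b => x + Pi.single p.μ a + Pi.single p.ν b
  have hstep : ∀ {y : Pt P.d} {c : Site P 0}, cover P y = c → ∀ μ, cover P (y + Pi.single μ 1) = c.shift μ := by
    intro y c hy μ
    have h := cover_add_single_pow (P := P) 0 (c := c) hy μ
    rwa [pow_zero] at h
  have hq00 : cover P (q 0 0) = p.src := by
    show cover P (x + Pi.single p.μ 0 + Pi.single p.ν 0) = _
    rw [Pi.single_zero, Pi.single_zero, add_zero, add_zero, hxdef, cover_lift]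
  have hq10 : cover P (q 1 0) = p.src.shift p.μ := by
    show cover P (x + Pi.single p.μ 1 + Pi.single p.ν 0) = _
    rw [Pi.single_zero, add_zero, hstep (by rw [hxdef, cover_lift]) p.μ]
  have hq01 : cover P (q 0 1) = p.src.shift p.ν := by
    show cover P (x + Pi.single p.μ 0 + Pi.single p.ν 1) = _
    rw [Pi.single_zero, add_zero, hstep (by rw [hxdef, cover_lift]) p.ν]
  have hq11 : cover P (q 1 1) = (p.src.shift p.μ).shift p.ν := by
    show cover P (x + Pi.single p.μ 1 + Pi.single p.ν 1) = _
    rw [hstep _ p.ν]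
    rw [hstep (by rw [hxdef, cover_lift]) p.μ]
  have hne : p.μ ≠ p.ν := ne_of_lt p.hμν
  -- one corner lies in `Ω₁(Z)`
  have h0 : ∃ a b, (a = 0 ∨ a = 1) ∧ (b = 0 ∨ b = 1) ∧ cover P (q a b) ∈ maxDomT M₁ Z (0 + 1) := by
    rcases hp' with h | h | h | h
    · exact ⟨0, 0, Or.inl rfl, Or.inl rfl, by rw [hq00]; exact h⟩
    · exact ⟨1, 0, Or.inr rfl, Or.inl rfl, by rw [hq10]; exact h⟩
    · exact ⟨0, 1, Or.inl rfl, Or.inr rfl, by rw [hq01]; exact h⟩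
    · exact ⟨1, 1, Or.inr rfl, Or.inr rfl, by rw [hq11]; exact h⟩
  obtain ⟨a₀, b₀, ha₀, hb₀, hmem⟩ := h0
  -- every corner is within `1 ≤ LM₁ − 1` of it, hence in `Ω₀(Z) = Z`
  have hL3 : (3 : ℤ) ≤ P.L := by
    have h1 := P.hL.2
    obtain ⟨r, hr⟩ := P.hL.1
    omega
  have hM' : (1 : ℤ) ≤ M₁ := by exact_mod_cast hM
  have hW : ∀ a b, (a = 0 ∨ a = 1) → (b = 0 ∨ b = 1) → Within ((side P.L M₁ (0 + 1) : ℤ) - 1) (q a₀ b₀) (q a b) := by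
    intro a b ha hb i
    have hside : (side P.L M₁ (0 + 1) : ℤ) = P.L * M₁ := by simp [side, Nat.cast_mul]
    rw [hside]
    exact (within_corner' x hne (zero_le_one) ha₀ hb₀ ha hb i).trans (by nlinarith)
  have H : ∀ a b, (a = 0 ∨ a = 1) → (b = 0 ∨ b = 1) → cover P (q a b) ∈ Z := fun a b ha hb => by
    have h := dist_maxDomT hM hdiv hJ hmem (hW a b ha hb)
    rwa [maxDomT_zero] at h
  refine ⟨?_, ?_, ?_, ?_⟩
  · rw [← hq00]; exact H 0 0 (Or.inl rfl) (Or.inl rfl)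
  · rw [← hq10]; exact H 1 0 (Or.inr rfl) (Or.inl rfl)
  · rw [← hq01]; exact H 0 1 (Or.inl rfl) (Or.inr rfl)
  · rw [← hq11]; exact H 1 1 (Or.inr rfl) (Or.inr rfl)

end ZRanges

/-! ## §3  At `Z`'s maximal sequence: the datum row of N12's junction, ranges discharged -/

section Record

open B14.Eq213MaximalDomains (side)
open B14.Eq213DetSet (maxDomT)

variable {P : Params} {G : Type*} [GaugeGroup G]

/-- ★★ **THE (1.74) DATUM `M˙(Q_k^{s*}V)` IS REGULAR-REALISED ALONG `Z`'s MAXIMAL SEQUENCE (2.13), RANGES DISCHARGED** — §1 at `Ω := maxDomT M₁ Z` ([III] (2.13)), `Ω₀ := hullD P M₁ 1 (Ω₁(Z))`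
(node00-def-R's support of record, [III] p. 255), `Y := Z` (a union of `k`-blocks, [IV] (1.70)–(1.73)), for Bałaban's averaging `blockAvg ℰ` (`ℰ(1,…,1) = 1`), `2 ≤ M₁`, `1 ≤ k ≤ m + K`,
the torus divisibility `LᵏM₁ ∣ 2L^{m+K}`, positive thresholds and `V` small on the plaquettes inside `Z^{(k)}` at each of them: the three range letters of §1 are r11's printed distance
condition (§2, g12's `plaqsOf_pts_maxDomT_subset_plaqsInside`).  The one-call discharge of the regular-realised data row for N12's junction datum `M˙(Q_k^{s*}Ṽ_k)`, `Ṽ_k = ext V_k`.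
[cite: Balaban1989LargeFieldI, (1.74) p.192, p.193 L14–20; Balaban1988Convergent, p.255, (2.11)–(2.13) pp.256–257, (2.16) p.257; Balaban1985Variational, (7) p.278, (11) p.279, (14) p.280] -/
theorem dataRegularRealisedTop_avgFamily_qsstarGIter0_maxDomT (hd : 2 ≤ P.d) (ℰ : LoopAverage G)
    (hE : ∀ n : ℕ, ℰ.E (fun _ : Fin (n + 1) => (1 : G)) = 1) {av : ∀ j, Averaging P j G} (hav : av = fun _ => blockAvg ℰ)
    {M₁ : ℕ} (hM2 : 2 ≤ M₁) {Z : Set (Site P 0)} {k : ℕ} (hk1 : 1 ≤ k) (hk : k ≤ P.m + P.K)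
    (hdiv : side P.L M₁ k ∣ P.sitesPerDir 0) (hZblk : IsBlockUnion k Z)
    {δ : ℕ → ℝ} (hδ : ∀ j, j ≤ k → 0 < δ j) (V : GaugeField P k G) (hV : ∀ j, j ≤ k → PlaqSmallOn (plaqsInside (pts k Z)) (δ j) V) :
    DataRegularRealisedTop av (maxDomT M₁ Z) (Node00.hullD P M₁ 1 (maxDomT M₁ Z 1)) k δ (avgFamily av (qsstarGIter0 k V)) :=
  have hM : 1 ≤ M₁ := le_trans one_le_two hM2
  dataRegularRealisedTop_avgFamily_qsstarGIter0 hd ℰ hE hav hk (maxDomT M₁ Z) _ Z hZblk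
    (plaqsOf_hullD_maxDomT_one_subset_plaqsInside hM hdiv hk1) (plaqsOf_maxDomT_one_subset_plaqsInside hM hdiv hk1)
    (fun _ hn1 hn => plaqsOf_pts_maxDomT_subset_plaqsInside hM2 hdiv hn1 hn)
    (hδ 0 (Nat.zero_le _)) (hδ 1 hk1) (fun j _ hj => hδ j hj) V (hV 0 (Nat.zero_le _)) (hV 1 hk1) (fun j _ hj => hV j hj)

end Record

end Literature.MathematicalPhysics.QuantumFieldTheory.Balaban1983to89.B11Thm1ExistsUniqueRealisedDataB

end
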